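import Mathlib
import Summits.Ventures.PercRepro2.Defs
import Summits.Ventures.PercRepro2.Independence
import Summits.Ventures.PercRepro2.Harris
import Summits.Ventures.PercRepro2.CoinDefs
import Summits.Ventures.PercRepro2.CoinArcsOff
import Summits.Ventures.PercRepro2.CoinPendantDefs
import Summits.Ventures.PercRepro2.CoinVdBK
import Summits.Ventures.PercRepro2.CoinLemmaA
import Summits.Ventures.PercRepro2.CoinTraceLevels
import Summits.Ventures.PercRepro2.CoinKStarLattice
import Summits.Ventures.PercRepro2.CoinKStarTilt
import Summits.Ventures.PercRepro2.CoinKStarLaw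

/-!
# The trace law of a k-STAR head, and the avoidance function of the reduced system
(blind cell PercRepro2, night-2 g5; proofs/NIGHT2-DARC.md §26.1)

For the head `P = {w} ∪ Vs` with arm coins `c v = {w → v}` and leaf coins `d v = {v → t}`
(`v ∈ Vs`): `v ∈ K⁻ ⟺ d v` open, `w ∈ K⁻ ⟺ ∃ v, c v ∧ d v` open.  The level of a trace `L ⊆ Vs`
is the CYLINDER «`d v` open exactly for `v ∈ L`, every `c v` (`v ∈ L`) closed», of probability
`kA L = leafLaw L · armProd L` (`prob_cylinder`); the level of `L ∪ {w}` is the difference of two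
cylinders, of probability `kB L = leafLaw L · (1 − armProd L)` — with `β v = p (d v)` and
`q v = 1 − p (c v)`.  Also: `massE_marker_avoid` (the marker mass on an avoidance event is a
difference of two avoidance probabilities) and `prob_avoid_lsm` (log-supermodularity of
`X ↦ P(R_X)`, `vdBKC` with `A = B = ∅`).
-/

namespace Summit.Ventures.PercRepro2.Coin

section KStarTrace

open Classical

variable {V : Type*} {E : Type*} [Fintype V] [DecidableEq V] [Fintype E] [DecidableEq E]
  {R : Type*} [Field R] [LinearOrder R] [IsStrictOrderedRing R]

omit [Fintype V] [Fintype E] [DecidableEq E] in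
/-- `R_{U ∪ {a}} = {a ∉ S⁺} ∩ R_U`. -/
lemma avoidEvent_insert (arcs : E → Finset (V × V)) (s a : V) (U : Finset V) :
    avoidEvent arcs s (insert a U) = (fwdEvent arcs s a)ᶜ ∩ avoidEvent arcs s U := by
  ext ω
  simp only [avoidEvent, fwdEvent, Set.mem_setOf_eq, Set.mem_inter_iff, Set.mem_compl_iff,
    Finset.forall_mem_insert]

omit [Fintype V] [LinearOrder R] [IsStrictOrderedRing R] in
/-- `E[X; R_U] = P(R_U) − P(R_{U ∪ {a}})` for the marker `X = 1[a ∈ S⁺]`. -/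
lemma massE_marker_avoid (p : E → R) (arcs : E → Finset (V × V)) (s a : V) (U : Finset V) :
    massE p (marker (R := R) arcs s a) (avoidEvent arcs s U) =
      prob p (avoidEvent arcs s U) - prob p (avoidEvent arcs s (insert a U)) := by
  rw [massE_marker_eq_prob, avoidEvent_insert]
  have h := prob_inter_add_prob_inter_compl p (avoidEvent arcs s U) (fwdEvent arcs s a)
  rw [Set.inter_comm, Set.inter_comm (avoidEvent arcs s U) (fwdEvent arcs s a)ᶜ] at h
  linear_combination h

/-- Log-supermodularity of `X ↦ P(R_X)` on a `SameEnds` coin system (`vdBKC`, `A = B = ∅`). -/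
lemma prob_avoid_lsm (p : E → R) (hp : IsProbVec p) {arcs : E → Finset (V × V)}
    (hS : SameEnds arcs) (s : V) (X Y : Finset V) :
    prob p (avoidEvent arcs s X) * prob p (avoidEvent arcs s Y) ≤
      prob p (avoidEvent arcs s (X ∩ Y)) * prob p (avoidEvent arcs s (X ∪ Y)) := by
  have h := vdBKC p hp hS s ∅ ∅ X Y
  simpa only [connAllC_empty, Set.univ_inter, Finset.empty_union] using h

omit [Fintype V] [DecidableEq V] [Fintype E] [DecidableEq E] [LinearOrder R]
  [IsStrictOrderedRing R] in
/-- `R_X` shrinks as `X` grows. -/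
lemma avoidEvent_anti (arcs : E → Finset (V × V)) (s : V) {X Y : Finset V} (h : X ⊆ Y) :
    avoidEvent arcs s Y ⊆ avoidEvent arcs s X := fun _ hω x hx => hω x (h hx)

omit [Fintype V] [Field R] [LinearOrder R] [IsStrictOrderedRing R] in
/-- `(S ∪ {t}) ∩ (S' ∪ {t}) = (S ∩ S') ∪ {t}`. -/
lemma union_singleton_inter (S S' : Finset V) (t : V) :
    (S ∪ {t}) ∩ (S' ∪ {t}) = (S ∩ S') ∪ {t} := by
  ext x; simp only [Finset.mem_inter, Finset.mem_union, Finset.mem_singleton]; tauto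

omit [Fintype V] [Field R] [LinearOrder R] [IsStrictOrderedRing R] in
/-- `(S ∪ {t}) ∪ (S' ∪ {t}) = (S ∪ S') ∪ {t}`. -/
lemma union_singleton_union (S S' : Finset V) (t : V) :
    (S ∪ {t}) ∪ (S' ∪ {t}) = (S ∪ S') ∪ {t} := by
  ext x; simp only [Finset.mem_union, Finset.mem_singleton]; tauto

/-! ### The cylinders of the star -/

/-- The coin states of the trace `L`: the leaf coins of `L` open, everything else closed. -/
def starState (d : V → E) (L : Finset V) : Config E := fun e => decide (∃ v ∈ L, e = d v)

omit [Fintype V] [Fintype E] [Field R] [LinearOrder R] [IsStrictOrderedRing R] in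
/-- The state of the leaf coin `d v` in the trace `L` is «open iff `v ∈ L`». -/
lemma starState_leaf {Vs : Finset V} {d : V → E} (hd : Set.InjOn d Vs) {L : Finset V}
    (hL : L ⊆ Vs) {v : V} (hv : v ∈ Vs) : starState d L (d v) = decide (v ∈ L) := by
  simp only [starState]
  by_cases h : v ∈ L
  · simp only [h, decide_true, decide_eq_true_eq]
    exact ⟨v, h, rfl⟩
  · simp only [h, decide_false, decide_eq_false_iff_not, not_exists, not_and]
    intro v' hv' he
    exact h (hd hv (hL hv') he ▸ hv')

omit [Fintype V] [DecidableEq V] [Fintype E] [Field R] [LinearOrder R] [IsStrictOrderedRing R] in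
/-- Every arm coin is closed in the state of a trace. -/
lemma starState_arm {Vs : Finset V} {c d : V → E} (hcd : ∀ v ∈ Vs, ∀ v' ∈ Vs, c v ≠ d v')
    {L : Finset V} (hL : L ⊆ Vs) {v : V} (hv : v ∈ Vs) : starState d L (c v) = false := by
  simp only [starState, decide_eq_false_iff_not, not_exists, not_and]
  intro v' hv' he
  exact hcd v hv v' (hL hv') he

omit [Fintype V] [Fintype E] [Field R] [LinearOrder R] [IsStrictOrderedRing R] in
/-- The level of a trace `L ⊆ Vs` (`w ∉ K⁻`) is the cylinder on the leaf coins of `Vs` and the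
arm coins of `L`. -/
lemma traceLevel_kStar_notMem {arcs : E → Finset (V × V)} {Vs : Finset V} {w t : V}
    (hwV : w ∉ Vs) {c d : V → E} (hcd : ∀ v ∈ Vs, ∀ v' ∈ Vs, c v ≠ d v') (hd : Set.InjOn d Vs)
    (hleaf : ∀ v ∈ Vs, bwdEvent arcs v {t} = openEdge (d v))
    (hhead : bwdEvent arcs w {t} = ⋃ v ∈ Vs, (openEdge (c v) ∩ openEdge (d v)))
    {L : Finset V} (hL : L ⊆ Vs) :
    traceLevel arcs {t} (insert w Vs) L = cylinder (Vs.image d ∪ L.image c) (starState d L) := by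
  ext ω
  simp only [traceLevel, Set.mem_setOf_eq, Finset.forall_mem_insert, mem_cylinder,
    Finset.mem_union, Finset.mem_image]
  have hwL : w ∉ L := fun h => hwV (hL h)
  constructor
  · rintro ⟨hw, hv⟩ e he
    rcases he with ⟨v, hv', rfl⟩ | ⟨v, hv', rfl⟩
    · rw [starState_leaf hd hL hv']
      have := hv v hv'
      rw [hleaf v hv'] at this
      by_cases h : v ∈ L
      · simp only [h, decide_true]; exact this.mp h
      · simp only [h, decide_false]
        exact Bool.eq_false_iff.mpr fun h' => h (this.mpr h')
    · rw [starState_arm hcd hL (hL hv')]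
      have hwK : ω ∉ bwdEvent arcs w {t} := fun h => hwL (hw.mpr h)
      rw [hhead] at hwK
      simp only [Set.mem_iUnion, Set.mem_inter_iff, not_exists, not_and] at hwK
      have hdv : ω (d v) = true := by
        have := hv v (hL hv')
        rw [hleaf v (hL hv')] at this
        exact this.mp hv'
      exact Bool.eq_false_iff.mpr fun h => hwK v (hL hv') h hdv
  · intro h
    have hleafs : ∀ v ∈ Vs, (v ∈ L ↔ ω ∈ bwdEvent arcs v {t}) := by
      intro v hv
      rw [hleaf v hv]
      have := h (d v) (Or.inl ⟨v, hv, rfl⟩)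
      rw [starState_leaf hd hL hv] at this
      show v ∈ L ↔ ω (d v) = true
      rw [this]
      by_cases hvL : v ∈ L <;> simp [hvL]
    refine ⟨?_, hleafs⟩
    constructor
    · intro h'; exact absurd h' hwL
    · intro hw
      rw [hhead] at hw
      simp only [Set.mem_iUnion, Set.mem_inter_iff] at hw
      obtain ⟨v, hv, hc, hd'⟩ := hw
      have hvL : v ∈ L := (hleafs v hv).mpr (by rw [hleaf v hv]; exact hd')
      have := h (c v) (Or.inr ⟨v, hvL, rfl⟩)
      rw [starState_arm hcd hL hv] at this
      exact absurd (this ▸ hc) Bool.false_ne_true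

omit [Fintype V] [Fintype E] [Field R] [LinearOrder R] [IsStrictOrderedRing R] in
/-- The level of the trace `L ∪ {w}` (`w ∈ K⁻`) is the cylinder on the leaf coins of `Vs` minus the
cylinder where also every arm coin of `L` is closed. -/
lemma traceLevel_kStar_mem {arcs : E → Finset (V × V)} {Vs : Finset V} {w t : V}
    (hwV : w ∉ Vs) {c d : V → E} (hcd : ∀ v ∈ Vs, ∀ v' ∈ Vs, c v ≠ d v') (hd : Set.InjOn d Vs)
    (hleaf : ∀ v ∈ Vs, bwdEvent arcs v {t} = openEdge (d v))
    (hhead : bwdEvent arcs w {t} = ⋃ v ∈ Vs, (openEdge (c v) ∩ openEdge (d v)))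
    {L : Finset V} (hL : L ⊆ Vs) :
    traceLevel arcs {t} (insert w Vs) (insert w L) =
      cylinder (Vs.image d) (starState d L) \ cylinder (Vs.image d ∪ L.image c) (starState d L) := by
  ext ω
  simp only [traceLevel, Set.mem_setOf_eq, Finset.forall_mem_insert, Set.mem_sdiff, mem_cylinder,
    Finset.mem_union, Finset.mem_image, Finset.mem_insert_self, true_iff]
  have hvins : ∀ v ∈ Vs, (v ∈ insert w L ↔ v ∈ L) := fun v hv =>
    ⟨fun h => (Finset.mem_insert.mp h).resolve_left fun h' => hwV (h' ▸ hv), fun h =>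
      Finset.mem_insert_of_mem h⟩
  constructor
  · rintro ⟨hw, hv⟩
    have hleafs : ∀ v ∈ Vs, ω (d v) = decide (v ∈ L) := by
      intro v hv'
      have := hv v hv'
      rw [hvins v hv', hleaf v hv'] at this
      by_cases h : v ∈ L
      · simp only [h, decide_true]; exact this.mp h
      · simp only [h, decide_false]
        exact Bool.eq_false_iff.mpr fun h' => h (this.mpr h')
    refine ⟨?_, ?_⟩
    · rintro e ⟨v, hv', rfl⟩
      rw [starState_leaf hd hL hv']; exact hleafs v hv'
    · intro hall
      rw [hhead] at hw
      simp only [Set.mem_iUnion, Set.mem_inter_iff] at hw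
      obtain ⟨v, hv', hc, hd'⟩ := hw
      have hvL : v ∈ L := by
        have := hleafs v hv'
        rw [hd'] at this
        exact of_decide_eq_true this.symm
      have := hall (c v) (Or.inr ⟨v, hvL, rfl⟩)
      rw [starState_arm hcd hL hv'] at this
      exact absurd (this ▸ hc) Bool.false_ne_true
  · rintro ⟨hcyl, hnot⟩
    have hleafs : ∀ v ∈ Vs, ω (d v) = decide (v ∈ L) := fun v hv => by
      have := hcyl (d v) ⟨v, hv, rfl⟩
      rwa [starState_leaf hd hL hv] at this
    refine ⟨?_, fun v hv => ?_⟩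
    · rw [hhead]
      simp only [Set.mem_iUnion, Set.mem_inter_iff]
      by_contra hcon
      simp only [not_exists, not_and] at hcon
      apply hnot
      intro e he
      rcases he with ⟨v, hv', rfl⟩ | ⟨v, hv', rfl⟩
      · rw [starState_leaf hd hL hv']; exact hleafs v hv'
      · rw [starState_arm hcd hL (hL hv')]
        have hdv : ω (d v) = true := by rw [hleafs v (hL hv')]; simp [hv']
        exact Bool.eq_false_iff.mpr fun h => hcon v (hL hv') h hdv
    · rw [hvins v hv, hleaf v hv]
      show v ∈ L ↔ ω (d v) = true
      rw [hleafs v hv]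
      by_cases hvL : v ∈ L <;> simp [hvL]

/-! ### The probabilities of the levels -/

omit [Fintype V] [LinearOrder R] [IsStrictOrderedRing R] in
/-- The leaf cylinder has probability `leafLaw L` (`β v = p (d v)`). -/
lemma prob_cylinder_leaf (p : E → R) {Vs : Finset V} {d : V → E} (hd : Set.InjOn d Vs)
    {L : Finset V} (hL : L ⊆ Vs) :
    prob p (cylinder (Vs.image d) (starState d L)) = leafLaw Vs (fun v => p (d v)) L := by
  rw [prob_cylinder, Finset.prod_image (fun x hx y hy h => hd hx hy h)]
  simp only [leafLaw]
  refine Finset.prod_congr rfl fun v hv => ?_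
  rw [starState_leaf hd hL hv]
  by_cases h : v ∈ L <;> simp [h, edgeFactor]

omit [Fintype V] [LinearOrder R] [IsStrictOrderedRing R] in
/-- The arm-and-leaf cylinder has probability `kA L = leafLaw L · armProd L`
(`q v = 1 − p (c v)`). -/
lemma prob_cylinder_leaf_arm (p : E → R) {Vs : Finset V} {c d : V → E}
    (hcd : ∀ v ∈ Vs, ∀ v' ∈ Vs, c v ≠ d v') (hc : Set.InjOn c Vs) (hd : Set.InjOn d Vs)
    {L : Finset V} (hL : L ⊆ Vs) :
    prob p (cylinder (Vs.image d ∪ L.image c) (starState d L)) =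
      kA Vs (fun v => p (d v)) (fun v => 1 - p (c v)) L := by
  have hdisj : Disjoint (Vs.image d) (L.image c) := by
    rw [Finset.disjoint_left]
    rintro e he he'
    obtain ⟨v, hv, rfl⟩ := Finset.mem_image.mp he
    obtain ⟨v', hv', he''⟩ := Finset.mem_image.mp he'
    exact hcd v' (hL hv') v hv he''
  rw [prob_cylinder, Finset.prod_union hdisj, Finset.prod_image (fun x hx y hy h => hd hx hy h),
    Finset.prod_image (fun x hx y hy h => hc (hL hx) (hL hy) h)]
  simp only [kA, leafLaw, armProd]
  congr 1
  · refine Finset.prod_congr rfl fun v hv => ?_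
    rw [starState_leaf hd hL hv]
    by_cases h : v ∈ L <;> simp [h, edgeFactor]
  · refine Finset.prod_congr rfl fun v hv => ?_
    rw [starState_arm hcd hL (hL hv)]
    simp [edgeFactor]

omit [Fintype V] [LinearOrder R] [IsStrictOrderedRing R] in
/-- **The trace law of the star at `L`** (`w ∉ K⁻`): `P(K⁻ ∩ P = L) = kA L`. -/
theorem prob_traceLevel_kStar_notMem (p : E → R) {arcs : E → Finset (V × V)} {Vs : Finset V}
    {w t : V} (hwV : w ∉ Vs) {c d : V → E} (hcd : ∀ v ∈ Vs, ∀ v' ∈ Vs, c v ≠ d v')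
    (hc : Set.InjOn c Vs) (hd : Set.InjOn d Vs)
    (hleaf : ∀ v ∈ Vs, bwdEvent arcs v {t} = openEdge (d v))
    (hhead : bwdEvent arcs w {t} = ⋃ v ∈ Vs, (openEdge (c v) ∩ openEdge (d v)))
    {L : Finset V} (hL : L ⊆ Vs) :
    prob p (traceLevel arcs {t} (insert w Vs) L) =
      kA Vs (fun v => p (d v)) (fun v => 1 - p (c v)) L := by
  rw [traceLevel_kStar_notMem hwV hcd hd hleaf hhead hL, prob_cylinder_leaf_arm p hcd hc hd hL]

omit [Fintype V] [LinearOrder R] [IsStrictOrderedRing R] in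
/-- **The trace law of the star at `L ∪ {w}`** (`w ∈ K⁻`): `P(K⁻ ∩ P = L ∪ {w}) = kB L`. -/
theorem prob_traceLevel_kStar_mem (p : E → R) {arcs : E → Finset (V × V)} {Vs : Finset V}
    {w t : V} (hwV : w ∉ Vs) {c d : V → E} (hcd : ∀ v ∈ Vs, ∀ v' ∈ Vs, c v ≠ d v')
    (hc : Set.InjOn c Vs) (hd : Set.InjOn d Vs)
    (hleaf : ∀ v ∈ Vs, bwdEvent arcs v {t} = openEdge (d v))
    (hhead : bwdEvent arcs w {t} = ⋃ v ∈ Vs, (openEdge (c v) ∩ openEdge (d v)))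
    {L : Finset V} (hL : L ⊆ Vs) :
    prob p (traceLevel arcs {t} (insert w Vs) (insert w L)) =
      kB Vs (fun v => p (d v)) (fun v => 1 - p (c v)) L := by
  rw [traceLevel_kStar_mem hwV hcd hd hleaf hhead hL]
  have hsub : cylinder (Vs.image d ∪ L.image c) (starState d L) ⊆
      cylinder (Vs.image d) (starState d L) :=
    fun ω hω e he => hω e (Finset.mem_union_left _ he)
  have h := prob_union_of_disjoint p (Set.disjoint_sdiff_right (s := cylinder (Vs.image d ∪ L.image c) (starState d L)) (t := cylinder (Vs.image d) (starState d L)))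
  rw [Set.union_sdiff_cancel hsub, prob_cylinder_leaf p hd hL,
    prob_cylinder_leaf_arm p hcd hc hd hL] at h
  simp only [kA] at h
  simp only [kB]
  linear_combination -h

end KStarTrace

end Summit.Ventures.PercRepro2.Coin
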